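import Literature.Probability.Percolation.TwoSetExchange
import HarnessLib

/-!
# Two pairs of terminals: the typed two-cluster "split" inequality
# `μ(av|bc) · μ(a|b|c|v) ≤ μ(av|b|c) · μ(a|bc|v)` (van den Berg–Häggström–Kahn 2006, Thm. 2.1 at
# `q = 1` with `S = {a, v}`, `T = {b, c}`)

Topic `Literature/Probability/Percolation`.  Proofs only: no definitions, no named facts.

Bond percolation with arbitrary edge probabilities `w : Sym2 V → [0,1]` on a finite vertex type `V`
(`μ = prodBernoulli w` on `BondConfig V = Set (Sym2 V)`), four vertices `a, v, b, c`.  Write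
`N = {a ↮ b} ∩ {a ↮ c} ∩ {v ↮ b} ∩ {v ↮ c}` ("no open path joins `{a, v}` to `{b, c}`") and, on `N`,
the four connection patterns of the two pairs

* `av|bc  = N ∩ {a ↔ v} ∩ {b ↔ c}`   (both pairs joined, necessarily in two distinct clusters),
* `av|b|c = N ∩ {a ↔ v} ∩ {b ↮ c}`,  `a|bc|v = N ∩ {a ↮ v} ∩ {b ↔ c}`,
* `a|b|c|v = N ∩ {a ↮ v} ∩ {b ↮ c}`.

The results of this file:

* `twoPair_negCorrelation` — `μ(N) · μ(N ∩ {a ↔ v} ∩ {b ↔ c}) ≤ μ(N ∩ {a ↔ v}) · μ(N ∩ {b ↔ c})`: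
  given that the pairs `{a, v}` and `{b, c}` are not joined to each other, the events "`a ↔ v`" and
  "`b ↔ c`" are negatively correlated;
* `twoPairSplit` — the equivalent `2 × 2` (odds) form
  `μ(av|bc) · μ(a|b|c|v) ≤ μ(av|b|c) · μ(a|bc|v)`;
* `twoPairSplit_piece2` — the companion instance with `S = {a}`, `T = {b, c}` ("PIECE-2"):
  `μ(av|bc) · [μ(a|bv|c) + μ(a|b|cv)] ≤ μ(av|b|c) · μ(a|bcv)`, the bracket and the last factor being
  the single events `{a↮b} ∩ {a↮c} ∩ {b↮c} ∩ ({b↔v} ∪ {c↔v})` and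
  `{a↮b} ∩ {a↮c} ∩ {b↔c} ∩ ({b↔v} ∪ {c↔v})`.  Adding `twoPairSplit` and `twoPairSplit_piece2` gives
  the untyped row `x · (u + μ(a|bv|c) + μ(a|b|cv)) ≤ y · (z + μ(a|bcv))`, which is Thm. 2.1 for
  `S = {a}`, `T = {b, c}` with `f = 1{a ↔ v}`, `g = 1{b ↮ c}` (Thm. 1.5 with `t` replaced by the set
  `{b, c}`; the `2 × 2` table of `({a↔v}, {b↔c})` on `{a↮b} ∩ {a↮c}` has the cells `x`, `y`,
  `z + μ(a|bcv)`, `u + μ(a|bv|c) + μ(a|b|cv)`).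

## Source and proof

[VandenbergHaggstromKahn2005, Thm. 2.1 (arXiv p. 6 / RSA p. 9)]: "Consider a distribution (rcdef) with
`q ≥ 1`. Let `S` and `T` be disjoint sets of vertices, and `f` and `g` bounded, measurable functions
of `(C_S, C_T)`, each increasing in `C_S` and decreasing in `C_T`. Then on `{S ↛ T}`, `E f g ≥ E f E g`"
(`C_S` = "the set of edges belonging to open paths starting at vertices of `S`"; at `q = 1` the
random-cluster measure is the product measure — the tree theorem
`BHK2006_twoSetConditionalAssociation`, with its event form `setTwoClusterExchange` in
`TwoSetExchange.lean`).  Take `S = {a, v}`, `T = {b, c}`: then `{S ↮ T} = N`, the event `{a ↔ v}` is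
closed under enlarging `C_S` (type `(+)`, `TwoSetExchange.typePlus_openConn_of_mem`) and `{b ↔ c}`
is closed under enlarging `C_T` (type `(−)`, `TwoSetExchange.typeMinus_openConn_of_mem`), so the
event form with `A₁ = {a ↔ v}`, `B₁ = {b ↔ c}`, `A₂ = B₂ = Ω` reads
`μ(N ∩ {a↔v} ∩ {b↔c}) · μ(N) ≤ μ(N ∩ {a↔v}) · μ(N ∩ {b↔c})` — `twoPair_negCorrelation`; and with
`x = μ(av|bc)`, `y = μ(av|b|c)`, `z = μ(a|bc|v)`, `u = μ(a|b|c|v)` this is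
`x (x + y + z + u) ≤ (x + y)(x + z)`, i.e. `x u ≤ y z` — `twoPairSplit`.  For `twoPairSplit_piece2`
take instead `S = {a}`, `T = {b, c}` (so `{S ↮ T} = {a↮b} ∩ {a↮c}`), `A₁ = {a ↔ v}` (type `(+)`),
`A₂ = {b ↮ c}` (type `(+)`, `typePlus_not_openConn_of_mem`), `B₁ = {b ↔ c}` (type `(−)`),
`B₂ = {T ↔ v} = {b ↔ v} ∪ {c ↔ v}` (type `(−)`, `typeMinus_biUnion_openConn`); on `{a ↔ v}` the
conditions `a ↮ b, a ↮ c` already force `v ↮ b, v ↮ c`, which identifies the first and third factors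
with the cells `av|bc`, `av|b|c` of the table above.

Status of the statement.  The display `μ(av|bc) μ(a|b|c|v) ≤ μ(av|b|c) μ(a|bc|v)` is not printed in
[VandenbergHaggstromKahn2005]; it is the instance `S = {a,v}`, `T = {b,c}`, `f = 1{a ↔ v}`,
`g = 1{b ↮ c}` of their Theorem 2.1 (equivalently of Thm. 1.4 "with `s`, `t` replaced by sets",
Remark 1 after Thm. 1.2, p. 5).  It was conjectured, under the name SPLIT ("typed two-cluster
negative dependence"), in the near-critical gluing programme of
`Summits/CriticalPhenomena/PercolationContinuityZ3` (crux `NoHeavyLowerTail`,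
stmt-CriticalPhenomena-4575; prover memo prim-ineq-gen-1 FINDING-12 §7), where an exhaustive
census found it with 0 violations on all connected multigraphs with `≤ 7` vertices and `≤ 10` edges.
NOT derived here (and not implied by the measure statement): the stronger INTERVAL ("antipodal
fibre") form of that memo — for every interval `[F, F ∪ W]` of configurations,
`#{Y ⊆ W : F ∪ Y ∈ av|bc, F ∪ (W∖Y) ∈ a|b|c|v} ≤ #{Y ⊆ W : F ∪ Y ∈ av|b|c, F ∪ (W∖Y) ∈ a|bc|v}` —
which remains a census-validated conjecture.

## References

* J. van den Berg, O. Häggström, J. Kahn, *Some conditional correlation inequalities for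
  percolation and related processes*, Random Structures Algorithms 29 (2006) 417–435
  (arXiv:math/0408176): Thm. 2.1 (p. 9), Thm. 1.4 / 1.5 (p. 7), Remark 1 after Thm. 1.2 (p. 5).
  [VandenbergHaggstromKahn2005]
-/

noncomputable section

open MeasureTheory Set
open Literature.Probability.LatticeModels (prodBernoulli)

namespace Literature.Probability.Percolation

variable {V : Type*}

namespace TwoPairClusterSplit

/-- The "no cross connection" event of the two pairs `{a, v}`, `{b, c}`, written with the block
separation event `{S ↮ T}` of `TwoSetExchange.lean` for `S = {a, v}`, `T = {b, c}`:
`{ω | ∀ s ∈ {a,v}, ∀ t ∈ {b,c}, s ↮ t} = {a↮b} ∩ {a↮c} ∩ {v↮b} ∩ {v↮c}`. [folklore] -/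
private theorem setSep_pair_pair_eq (a v b c : V) :
    {ω : BondConfig V | ∀ s ∈ ({a, v} : Set V), ∀ t ∈ ({b, c} : Set V),
        ¬ (openGraph ω).Reachable s t} =
      (openConn a b)ᶜ ∩ (openConn a c)ᶜ ∩ (openConn v b)ᶜ ∩ (openConn v c)ᶜ := by
  ext ω
  simp only [mem_insert_iff, mem_singleton_iff, forall_eq_or_imp, forall_eq, mem_setOf_eq,
    mem_inter_iff, mem_compl_iff, openConn]
  tauto

end TwoPairClusterSplit

open TwoPairClusterSplit TwoSetExchange in
/-- **Two pairs of terminals are negatively correlated given that they are not joined to each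
other** (van den Berg–Häggström–Kahn 2006, Thm. 2.1 at `q = 1` / Thm. 1.4 with the vertices replaced
by the sets `S = {a, v}`, `T = {b, c}`, for `f = 1{a ↔ v}`, `g = 1{b ↔ c}`): with
`N = {a↮b} ∩ {a↮c} ∩ {v↮b} ∩ {v↮c}`,
`μ(N) · μ(N ∩ ({a ↔ v} ∩ {b ↔ c})) ≤ μ(N ∩ {a ↔ v}) · μ(N ∩ {b ↔ c})`.
[cite: VandenbergHaggstromKahn2005, Thm. 2.1 (p. 9) at q = 1 with S = {a,v}, T = {b,c}; Remark 1 after Thm. 1.2 (p. 5) — corollary, derived in this file] -/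
theorem twoPair_negCorrelation [Fintype V] (w : Sym2 V → unitInterval) (a v b c : V) :
    (prodBernoulli w).real
        ((openConn a b)ᶜ ∩ (openConn a c)ᶜ ∩ (openConn v b)ᶜ ∩ (openConn v c)ᶜ) *
      (prodBernoulli w).real
        ((openConn a b)ᶜ ∩ (openConn a c)ᶜ ∩ (openConn v b)ᶜ ∩ (openConn v c)ᶜ ∩
          (openConn a v ∩ openConn b c)) ≤
    (prodBernoulli w).real
        ((openConn a b)ᶜ ∩ (openConn a c)ᶜ ∩ (openConn v b)ᶜ ∩ (openConn v c)ᶜ ∩ openConn a v) *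
      (prodBernoulli w).real
        ((openConn a b)ᶜ ∩ (openConn a c)ᶜ ∩ (openConn v b)ᶜ ∩ (openConn v c)ᶜ ∩ openConn b c) := by
  classical
  have ha : a ∈ ({a, v} : Set V) := mem_insert a {v}
  have hb : b ∈ ({b, c} : Set V) := mem_insert b {c}
  -- event form of BHK Thm. 2.1 (q = 1) with `A₁ = {a ↔ v}` (type (+)), `B₁ = {b ↔ c}` (type (−)),
  -- `A₂ = B₂ = Ω`
  have key := setTwoClusterExchange w ({a, v} : Set V) ({b, c} : Set V)
    (A₁ := (openConn a v : Set (BondConfig V))) (A₂ := (univ : Set (BondConfig V)))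
    (B₁ := (openConn b c : Set (BondConfig V))) (B₂ := (univ : Set (BondConfig V)))
    (typePlus_openConn_of_mem {a, v} {b, c} ha v) (fun _ _ _ _ _ => mem_univ _)
    (typeMinus_openConn_of_mem {a, v} {b, c} hb c) (fun _ _ _ _ _ => mem_univ _)
  rw [setSep_pair_pair_eq] at key
  simpa only [inter_univ, univ_inter, mul_comm] using key

open TwoPairClusterSplit in
/-- **The typed two-cluster split inequality ("SPLIT").**  For bond percolation with arbitrary edge
probabilities on a finite vertex type and four vertices `a, v, b, c`, with
`N = {a↮b} ∩ {a↮c} ∩ {v↮b} ∩ {v↮c}` and the pattern events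
`av|bc = N ∩ {a↔v} ∩ {b↔c}`, `a|b|c|v = N ∩ {a↮v} ∩ {b↮c}`, `av|b|c = N ∩ {a↔v} ∩ {b↮c}`,
`a|bc|v = N ∩ {a↮v} ∩ {b↔c}`:
`μ(av|bc) · μ(a|b|c|v) ≤ μ(av|b|c) · μ(a|bc|v)`.
The `2 × 2` form of `twoPair_negCorrelation` (`x(x+y+z+u) ≤ (x+y)(x+z) ↔ xu ≤ yz`).
[cite: VandenbergHaggstromKahn2005, Thm. 2.1 (p. 9) at q = 1 with S = {a,v}, T = {b,c} — corollary, derived in this file] -/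
theorem twoPairSplit [Fintype V] (w : Sym2 V → unitInterval) (a v b c : V) :
    (prodBernoulli w).real
        ((openConn a b)ᶜ ∩ (openConn a c)ᶜ ∩ (openConn v b)ᶜ ∩ (openConn v c)ᶜ ∩
          (openConn a v ∩ openConn b c)) *
      (prodBernoulli w).real
        ((openConn a b)ᶜ ∩ (openConn a c)ᶜ ∩ (openConn v b)ᶜ ∩ (openConn v c)ᶜ ∩
          ((openConn a v)ᶜ ∩ (openConn b c)ᶜ)) ≤
    (prodBernoulli w).real
        ((openConn a b)ᶜ ∩ (openConn a c)ᶜ ∩ (openConn v b)ᶜ ∩ (openConn v c)ᶜ ∩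
          (openConn a v ∩ (openConn b c)ᶜ)) *
      (prodBernoulli w).real
        ((openConn a b)ᶜ ∩ (openConn a c)ᶜ ∩ (openConn v b)ᶜ ∩ (openConn v c)ᶜ ∩
          ((openConn a v)ᶜ ∩ openConn b c)) := by
  classical
  have key := twoPair_negCorrelation w a v b c
  set μ := prodBernoulli w with hμ
  set N : Set (BondConfig V) :=
    (openConn a b)ᶜ ∩ (openConn a c)ᶜ ∩ (openConn v b)ᶜ ∩ (openConn v c)ᶜ with hN
  set A : Set (BondConfig V) := openConn a v with hA
  set B : Set (BondConfig V) := openConn b c with hB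
  have hAm : MeasurableSet A := MeasurableSet.of_discrete
  have hBm : MeasurableSet B := MeasurableSet.of_discrete
  -- the 2 × 2 table on `N`
  set x := μ.real (N ∩ (A ∩ B)) with hx
  set y := μ.real (N ∩ (A ∩ Bᶜ)) with hy
  set z := μ.real (N ∩ (Aᶜ ∩ B)) with hz
  set u := μ.real (N ∩ (Aᶜ ∩ Bᶜ)) with hu
  have hNA : μ.real (N ∩ A) = x + y := by
    rw [hx, hy, ← measureReal_inter_add_sdiff (s := N ∩ A) hBm]
    congr 2
    · rw [inter_assoc]
    · rw [sdiff_eq, inter_assoc]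
  have hNB : μ.real (N ∩ B) = x + z := by
    rw [hx, hz, ← measureReal_inter_add_sdiff (s := N ∩ B) hAm]
    congr 2
    · rw [inter_assoc, inter_comm B A]
    · rw [sdiff_eq, inter_assoc, inter_comm B Aᶜ]
  have hNAc : μ.real (N ∩ Aᶜ) = z + u := by
    rw [hz, hu, ← measureReal_inter_add_sdiff (s := N ∩ Aᶜ) hBm]
    congr 2
    · rw [inter_assoc]
    · rw [sdiff_eq, inter_assoc]
  have hNtot : μ.real N = x + y + (z + u) := by
    rw [← hNA, ← hNAc, ← measureReal_inter_add_sdiff (s := N) hAm, sdiff_eq]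
  rw [hNtot, hNA, hNB] at key
  have hx0 : 0 ≤ x := measureReal_nonneg
  -- `x (x + y + z + u) ≤ (x + y)(x + z)` gives `x u ≤ y z`
  nlinarith [key, hx0]

namespace TwoPairClusterSplit

/-- `{S ↮ T}` for `S = {a}`, `T = {b, c}` is `{a↮b} ∩ {a↮c}`. [folklore] -/
private theorem setSep_single_pair_eq (a b c : V) :
    {ω : BondConfig V | ∀ s ∈ ({a} : Set V), ∀ t ∈ ({b, c} : Set V),
        ¬ (openGraph ω).Reachable s t} =
      (openConn a b)ᶜ ∩ (openConn a c)ᶜ := by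
  ext ω
  simp only [mem_insert_iff, mem_singleton_iff, forall_eq_or_imp, forall_eq, mem_setOf_eq,
    mem_inter_iff, mem_compl_iff, openConn]

/-- On `{a ↔ v}`, the conditions `a ↮ b`, `a ↮ c` force `v ↮ b`, `v ↮ c` (transitivity of `↔`):
`{a↮b} ∩ {a↮c} ∩ ({a↔v} ∩ X) = N ∩ ({a↔v} ∩ X)` with `N = {a↮b} ∩ {a↮c} ∩ {v↮b} ∩ {v↮c}`.
[folklore] -/
private theorem sep_inter_openConn_eq (a v b c : V) (X : Set (BondConfig V)) :
    (openConn a b)ᶜ ∩ (openConn a c)ᶜ ∩ (openConn a v ∩ X) =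
      (openConn a b)ᶜ ∩ (openConn a c)ᶜ ∩ (openConn v b)ᶜ ∩ (openConn v c)ᶜ ∩ (openConn a v ∩ X) := by
  ext ω
  simp only [mem_inter_iff, mem_compl_iff, openConn, mem_setOf_eq]
  constructor
  · rintro ⟨⟨hab, hac⟩, hav, hX⟩
    exact ⟨⟨⟨⟨hab, hac⟩, fun hvb => hab (hav.trans hvb)⟩, fun hvc => hac (hav.trans hvc)⟩, hav, hX⟩
  · rintro ⟨⟨⟨⟨hab, hac⟩, -⟩, -⟩, hav, hX⟩
    exact ⟨⟨hab, hac⟩, hav, hX⟩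

end TwoPairClusterSplit

open TwoPairClusterSplit TwoSetExchange in
/-- **PIECE-2, the companion of SPLIT** (van den Berg–Häggström–Kahn 2006, Thm. 2.1 at `q = 1` with
`S = {a}`, `T = {b, c}`, `A₁ = {a ↔ v}`, `A₂ = {b ↮ c}`, `B₁ = {b ↔ c}`, `B₂ = {b ↔ v} ∪ {c ↔ v}`):
with `N = {a↮b} ∩ {a↮c} ∩ {v↮b} ∩ {v↮c}` and `D = {a↮b} ∩ {a↮c}`,
`μ(N ∩ {a↔v} ∩ {b↔c}) · μ(D ∩ {b↮c} ∩ ({b↔v} ∪ {c↔v}))`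
`  ≤ μ(N ∩ {a↔v} ∩ {b↮c}) · μ(D ∩ {b↔c} ∩ ({b↔v} ∪ {c↔v}))`,
i.e. in pattern language `μ(av|bc) · [μ(a|bv|c) + μ(a|b|cv)] ≤ μ(av|b|c) · μ(a|bcv)`
(`D ∩ {b↮c} ∩ ({b↔v} ∪ {c↔v}) = a|bv|c ⊔ a|b|cv`, `D ∩ {b↔c} ∩ ({b↔v} ∪ {c↔v}) = a|bcv`).
Added to `twoPairSplit` it gives the untyped row `x · (u + μ(a|bv|c) + μ(a|b|cv)) ≤ y · (z + μ(a|bcv))`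
(Thm. 2.1 for `S = {a}`, `T = {b, c}`, `f = 1{a ↔ v}`, `g = 1{b ↮ c}`).
[cite: VandenbergHaggstromKahn2005, Thm. 2.1 (p. 9) at q = 1 with S = {a}, T = {b,c} — corollary, derived in this file] -/
theorem twoPairSplit_piece2 [Fintype V] (w : Sym2 V → unitInterval) (a v b c : V) :
    (prodBernoulli w).real
        ((openConn a b)ᶜ ∩ (openConn a c)ᶜ ∩ (openConn v b)ᶜ ∩ (openConn v c)ᶜ ∩
          (openConn a v ∩ openConn b c)) *
      (prodBernoulli w).real
        ((openConn a b)ᶜ ∩ (openConn a c)ᶜ ∩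
          ((openConn b c)ᶜ ∩ (openConn b v ∪ openConn c v))) ≤
    (prodBernoulli w).real
        ((openConn a b)ᶜ ∩ (openConn a c)ᶜ ∩ (openConn v b)ᶜ ∩ (openConn v c)ᶜ ∩
          (openConn a v ∩ (openConn b c)ᶜ)) *
      (prodBernoulli w).real
        ((openConn a b)ᶜ ∩ (openConn a c)ᶜ ∩
          (openConn b c ∩ (openConn b v ∪ openConn c v))) := by
  classical
  have ha : a ∈ ({a} : Set V) := mem_singleton a
  have hb : b ∈ ({b, c} : Set V) := mem_insert b {c}
  -- event form of BHK Thm. 2.1 (q = 1) with `A₁ = {a ↔ v}`, `A₂ = {b ↮ c}` (type (+)),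
  -- `B₁ = {b ↔ c}`, `B₂ = {T ↔ v}` (type (−))
  have key := setTwoClusterExchange w ({a} : Set V) ({b, c} : Set V)
    (A₁ := (openConn a v : Set (BondConfig V))) (A₂ := (openConn b c : Set (BondConfig V))ᶜ)
    (B₁ := (openConn b c : Set (BondConfig V)))
    (B₂ := ⋃ t ∈ ({b, c} : Set V), (openConn t v : Set (BondConfig V)))
    (typePlus_openConn_of_mem {a} {b, c} ha v) (typePlus_not_openConn_of_mem {a} {b, c} hb c)
    (typeMinus_openConn_of_mem {a} {b, c} hb c) (typeMinus_biUnion_openConn {a} {b, c} v)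
  rw [setSep_single_pair_eq, biUnion_insert, biUnion_singleton, sep_inter_openConn_eq,
    sep_inter_openConn_eq] at key
  exact key

end Literature.Probability.Percolation
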